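import Mathlib
import Summits.AtomisticToContinuum.HydrodynamicLimit.Theorems.ImplosionDichotomyDenseExcursionCavityUniformOuter

/-!
# The junction zone of the energy regime: Grönwall across `Re Λ/8 ≤ e^{−x} ≤ 8‖Λ‖`
# (crux `DenseExcursion`, line `sonic-cavity-renewal`, bricks for stub `stub_cavityResolventCk`, theorem T7(iii))

Helper file (`--supports stmt-AtomisticToContinuum-12586`, line lead a2, stub-worker E3 for `stub_cavityResolventCk`,
energy regime `Re Λ → +∞` in a sector `‖Λ‖ ≤ ρ₀ Re Λ`).

**Mathematics.** Between the outer zone (`8e^{−x} ≤ Re Λ`, where the `p`-transport is dissipative, `cavity_outer_bound`)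
and the deep zone (`8‖Λ‖eˣ ≤ 1`, where the system is a small perturbation of the regular spherical-Bessel problem) lies the
JUNCTION ZONE `x_d = −log(8‖Λ‖) ≤ x ≤ x_e = log(8/Re Λ)` of length `log(64‖Λ‖/Re Λ) ≤ log(64ρ₀)` — bounded in the sector
`‖Λ‖ ≤ ρ₀ Re Λ`. There neither sign helps (`Re Λ − b₊₊ ≈ Re Λ − 2S` changes sign), but the characteristic system divided by
the speeds has coefficients `O(‖Λ‖/S + 1) = O(ρ₀)` (`junction_coeff_arith`: `|c₊| ≥ 0.49 e^{−x}`, `|c₋| ≥ 0.7e^{−x}`,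
`‖Λ‖ ≤ 8ρ₀e^{−x}`), so plain Grönwall (`norm_le_gronwallBound_of_norm_deriv_right_le`, run leftward from `x_e` on the pair
`(p, m)` with the sup norm, rate `30ρ₀`, inhomogeneity `10N`, datum `max(|p|,|m|)(x_e) ≤ 3N`) gives
`|p|, |m| ≤ 4N·(64ρ₀)^{30ρ₀}` on the junction zone (`cavity_junction_bound`), uniformly in `Im Λ` inside the sector.
Sources: folklore (Grönwall 1919; Hartman 2002 Ch. III). NOT here: the deep zone and the assembly (next files of worker E3).
-/

noncomputable section

open Filter Set
open scoped Topology ContDiff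

namespace Summit.AtomisticToContinuum.HydrodynamicLimit.Theorems.SonicCavityRenewal

open Summit.AtomisticToContinuum.HydrodynamicLimit.Theorems.R2OneModeTwoConditions

/-! ## Real arithmetic of the junction zone -/

/-- JUNCTION-ZONE ARITHMETIC: with `e = e^{−x} ≥ 6`, `(7/10)e ≤ S ≤ e`, the tube envelope, `1 < r < 2`, `1 ≤ ρ₀` and
`‖Λ‖ ≤ 8ρ₀e`, the coefficient sums of the characteristic system are at most `30ρ₀` times the speeds and the source weights
`1 + 3e` at most `10` times the speeds. [folklore] -/
theorem junction_coeff_arith (ρ₀ e Sv Wv W' S' r L : ℝ) (hρ : 1 ≤ ρ₀) (he : 6 ≤ e) (hS7 : 7 / 10 * e ≤ Sv)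
    (hSe : Sv ≤ e) (hW : |Wv| ≤ 1 / 4) (hW' : |W'| ≤ 1 / 2) (hσ : |Sv + S'| ≤ 5 / 8) (hr1 : 1 < r) (hr2 : r < 2)
    (hLe : L ≤ 8 * ρ₀ * e) :
    0 < Wv - 1 + Sv ∧
    L + |2 / 3 * W' + 2 * Wv - r + 2 * S' + 4 * Sv| + |W' / 3 + S' + 2 * Sv| ≤ 30 * ρ₀ * (Wv - 1 + Sv) ∧
    1 + 3 * e ≤ 10 * (Wv - 1 + Sv) ∧
    L + |2 / 3 * W' + 2 * Wv - r - 2 * S' - 4 * Sv| + |W' / 3 - S' - 2 * Sv| ≤ 30 * ρ₀ * (1 - Wv + Sv) ∧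
    1 + 3 * e ≤ 10 * (1 - Wv + Sv) := by
  obtain ⟨hW₁, hW₂⟩ := abs_le.mp hW
  obtain ⟨hW₁', hW₂'⟩ := abs_le.mp hW'
  obtain ⟨hσ₁, hσ₂⟩ := abs_le.mp hσ
  have hbpp : |2 / 3 * W' + 2 * Wv - r + 2 * S' + 4 * Sv| ≤ 409 / 100 + 2 * Sv :=
    abs_le.mpr ⟨by linarith, by linarith⟩
  have hbpm : |W' / 3 + S' + 2 * Sv| ≤ 4 / 5 + Sv := abs_le.mpr ⟨by linarith, by linarith⟩
  have hbmm : |2 / 3 * W' + 2 * Wv - r - 2 * S' - 4 * Sv| ≤ 409 / 100 + 2 * Sv :=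
    abs_le.mpr ⟨by linarith, by linarith⟩
  have hbmp : |W' / 3 - S' - 2 * Sv| ≤ 4 / 5 + Sv := abs_le.mpr ⟨by linarith, by linarith⟩
  have h3e : 3 * e ≤ 3 * ρ₀ * e := by nlinarith
  have h60 : 60 * ρ₀ ≤ 10 * ρ₀ * e := by nlinarith
  have hcp : 0 < Wv - 1 + Sv := by linarith
  refine ⟨hcp, ?_, by linarith, ?_, by linarith⟩
  · have : 30 * ρ₀ * (7 / 10 * e - 5 / 4) ≤ 30 * ρ₀ * (Wv - 1 + Sv) :=
      mul_le_mul_of_nonneg_left (by linarith) (by linarith)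
    nlinarith
  · have : 30 * ρ₀ * (7 / 10 * e - 5 / 4) ≤ 30 * ρ₀ * (1 - Wv + Sv) :=
      mul_le_mul_of_nonneg_left (by linarith) (by linarith)
    nlinarith

/-- The elementary bound `gronwallBound (3N) K (10N) T ≤ 4N e^{KT}` for `K ≥ 30`, `N, T ≥ 0`. [folklore] -/
theorem gronwallBound_le_four (N K T : ℝ) (hN : 0 ≤ N) (hK : 30 ≤ K) (hT : 0 ≤ T) :
    gronwallBound (3 * N) K (10 * N) T ≤ 4 * N * Real.exp (K * T) := by
  have hK0 : K ≠ 0 := by intro h; rw [h] at hK; norm_num at hK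
  rw [gronwallBound_of_K_ne_0 hK0]
  dsimp only
  have hexp : 1 ≤ Real.exp (K * T) := Real.one_le_exp (by positivity)
  have h1 : 10 * N / K * (Real.exp (K * T) - 1) ≤ 10 * N / K * Real.exp (K * T) :=
    mul_le_mul_of_nonneg_left (by linarith) (by positivity)
  have h2 : 10 * N / K ≤ N := by
    rw [div_le_iff₀ (by linarith)]; nlinarith
  have h3 : 10 * N / K * Real.exp (K * T) ≤ N * Real.exp (K * T) :=
    mul_le_mul_of_nonneg_right h2 (by positivity)
  nlinarith

/-- Norm of the right-hand side of the `p`-row: `‖(Λ − b₊₊)p − b₊₋m − (f + 3g)‖ ≤ (‖Λ‖ + |b₊₊| + |b₊₋|)·Z + N(1 + 3e)`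
when `‖p‖, ‖m‖ ≤ Z`, `‖f‖ ≤ N`, `‖g‖ ≤ Ne`. [folklore] -/
theorem row_norm_bound_p (Λ Pv Mv fv gv : ℂ) (bpp bpm Z N e : ℝ) (hP : ‖Pv‖ ≤ Z) (hM : ‖Mv‖ ≤ Z)
    (hf : ‖fv‖ ≤ N) (hg : ‖gv‖ ≤ N * e) :
    ‖(Λ - (bpp : ℂ)) * Pv - (bpm : ℂ) * Mv - (fv + 3 * gv)‖ ≤ (‖Λ‖ + |bpp| + |bpm|) * Z + N * (1 + 3 * e) := by
  have hΛb : ‖Λ - (bpp : ℂ)‖ ≤ ‖Λ‖ + |bpp| :=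
    calc ‖Λ - (bpp : ℂ)‖ ≤ ‖Λ‖ + ‖(bpp : ℂ)‖ := norm_sub_le _ _
      _ = ‖Λ‖ + |bpp| := by rw [Complex.norm_real, Real.norm_eq_abs]
  have t1 : ‖(Λ - (bpp : ℂ)) * Pv‖ ≤ (‖Λ‖ + |bpp|) * Z := by
    rw [norm_mul]; exact mul_le_mul hΛb hP (norm_nonneg _) (by positivity)
  have t2 : ‖(bpm : ℂ) * Mv‖ ≤ |bpm| * Z := by
    rw [norm_mul, Complex.norm_real, Real.norm_eq_abs]; exact mul_le_mul_of_nonneg_left hM (abs_nonneg _)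
  have t3 : ‖fv + 3 * gv‖ ≤ N * (1 + 3 * e) :=
    calc ‖fv + 3 * gv‖ ≤ ‖fv‖ + ‖3 * gv‖ := norm_add_le _ _
      _ = ‖fv‖ + 3 * ‖gv‖ := by rw [norm_mul]; norm_num
      _ ≤ N + 3 * (N * e) := by linarith
      _ = N * (1 + 3 * e) := by ring
  calc ‖(Λ - (bpp : ℂ)) * Pv - (bpm : ℂ) * Mv - (fv + 3 * gv)‖
      ≤ ‖(Λ - (bpp : ℂ)) * Pv - (bpm : ℂ) * Mv‖ + ‖fv + 3 * gv‖ := norm_sub_le _ _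
    _ ≤ ‖(Λ - (bpp : ℂ)) * Pv‖ + ‖(bpm : ℂ) * Mv‖ + ‖fv + 3 * gv‖ := by gcongr; exact norm_sub_le _ _
    _ ≤ (‖Λ‖ + |bpp|) * Z + |bpm| * Z + N * (1 + 3 * e) := by linarith
    _ = (‖Λ‖ + |bpp| + |bpm|) * Z + N * (1 + 3 * e) := by ring

/-- Norm of the right-hand side of the `m`-row: `‖−b₋₊p + (Λ − b₋₋)m − (f − 3g)‖ ≤ (‖Λ‖ + |b₋₋| + |b₋₊|)·Z + N(1 + 3e)`.
[folklore] -/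
theorem row_norm_bound_m (Λ Pv Mv fv gv : ℂ) (bmm bmp Z N e : ℝ) (hP : ‖Pv‖ ≤ Z) (hM : ‖Mv‖ ≤ Z)
    (hf : ‖fv‖ ≤ N) (hg : ‖gv‖ ≤ N * e) :
    ‖-(bmp : ℂ) * Pv + (Λ - (bmm : ℂ)) * Mv - (fv - 3 * gv)‖ ≤ (‖Λ‖ + |bmm| + |bmp|) * Z + N * (1 + 3 * e) := by
  have hΛb : ‖Λ - (bmm : ℂ)‖ ≤ ‖Λ‖ + |bmm| :=
    calc ‖Λ - (bmm : ℂ)‖ ≤ ‖Λ‖ + ‖(bmm : ℂ)‖ := norm_sub_le _ _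
      _ = ‖Λ‖ + |bmm| := by rw [Complex.norm_real, Real.norm_eq_abs]
  have t1 : ‖(Λ - (bmm : ℂ)) * Mv‖ ≤ (‖Λ‖ + |bmm|) * Z := by
    rw [norm_mul]; exact mul_le_mul hΛb hM (norm_nonneg _) (by positivity)
  have t2 : ‖-(bmp : ℂ) * Pv‖ ≤ |bmp| * Z := by
    rw [norm_mul, norm_neg, Complex.norm_real, Real.norm_eq_abs]
    exact mul_le_mul_of_nonneg_left hP (abs_nonneg _)
  have t3 : ‖fv - 3 * gv‖ ≤ N * (1 + 3 * e) :=
    calc ‖fv - 3 * gv‖ ≤ ‖fv‖ + ‖3 * gv‖ := norm_sub_le _ _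
      _ = ‖fv‖ + 3 * ‖gv‖ := by rw [norm_mul]; norm_num
      _ ≤ N + 3 * (N * e) := by linarith
      _ = N * (1 + 3 * e) := by ring
  calc ‖-(bmp : ℂ) * Pv + (Λ - (bmm : ℂ)) * Mv - (fv - 3 * gv)‖
      ≤ ‖-(bmp : ℂ) * Pv + (Λ - (bmm : ℂ)) * Mv‖ + ‖fv - 3 * gv‖ := norm_sub_le _ _
    _ ≤ ‖-(bmp : ℂ) * Pv‖ + ‖(Λ - (bmm : ℂ)) * Mv‖ + ‖fv - 3 * gv‖ := by gcongr; exact norm_add_le _ _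
    _ ≤ |bmp| * Z + (‖Λ‖ + |bmm|) * Z + N * (1 + 3 * e) := by linarith
    _ = (‖Λ‖ + |bmm| + |bmp|) * Z + N * (1 + 3 * e) := by ring

/-- Division of a row `c·P′ = R` by its speed: if `‖R‖ ≤ A Z + N E` with `A ≤ 30ρ₀|c|`, `E ≤ 10|c|`, then
`‖P′‖ ≤ 30ρ₀ Z + 10 N`. [folklore] -/
theorem row_deriv_bound (P' R : ℂ) (c A E Z N ρ₀ : ℝ) (hc : c ≠ 0) (heq : (c : ℂ) * P' = R)
    (hR : ‖R‖ ≤ A * Z + N * E) (hA : A ≤ 30 * ρ₀ * |c|) (hE : E ≤ 10 * |c|) (hZ : 0 ≤ Z) (hN : 0 ≤ N) :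
    ‖P'‖ ≤ 30 * ρ₀ * Z + 10 * N := by
  have hcpos : 0 < |c| := abs_pos.mpr hc
  have hn : |c| * ‖P'‖ = ‖R‖ := by rw [← heq, norm_mul, Complex.norm_real, Real.norm_eq_abs]
  have h1 : |c| * ‖P'‖ ≤ |c| * (30 * ρ₀ * Z + 10 * N) := by
    rw [hn]
    refine hR.trans ?_
    have u1 := mul_le_mul_of_nonneg_right hA hZ
    have u2 := mul_le_mul_of_nonneg_left hE hN
    nlinarith
  exact le_of_mul_le_mul_left h1 hcpos

/-! ## The junction-zone bound -/

/-- **Registered helper `cavity_junction_bound` (worker E3, theorem T7(iii) of `stub_cavityResolventCk`): THE JUNCTION ZONE OF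
THE ENERGY REGIME.** For a monatomic tube profile, `Re Λ ≥ 48`, `‖Λ‖ ≤ ρ₀ Re Λ`, a differentiable pair with finite weighted sup on
`x ≤ 1` solving the resolvent equations with source `|f| + eˣ|g| ≤ N` on `x ≤ 1`: on the junction zone
`Re Λ ≤ 8e^{−x}`, `1 ≤ 8‖Λ‖eˣ` one has `|ŵ ± 3ŝ| ≤ 4N·exp(30ρ₀ log(64ρ₀))` (Grönwall leftward from the outer zone over a length
`≤ log(64ρ₀)` with rate `≤ 30ρ₀`; uniform in `Im Λ` inside the sector). [folklore] -/
theorem cavity_junction_bound : ∀ (r : ℝ) (W S : ℝ → ℝ), IsMonatomicProfile r W S → CavityTube r W S → ∀ (Λ : ℂ) (f g ŵ ŝ : ℝ → ℂ) (N B ρ₀ : ℝ), 48 ≤ Λ.re → ‖Λ‖ ≤ ρ₀ * Λ.re → Differentiable ℝ ŵ → Differentiable ℝ ŝ → (∀ x, x ≤ 1 → Λ * ŵ x - linW r W S ŵ ŝ x = f x ∧ Λ * ŝ x - linS r W S ŵ ŝ x = g x) → (∀ x, x ≤ 1 → ‖f x‖ + Real.exp x * ‖g x‖ ≤ N) → (∀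 x, x ≤ 1 → ‖ŵ x‖ + Real.exp x * ‖ŝ x‖ ≤ B) → ∀ x, Λ.re ≤ 8 * Real.exp (-x) → 1 ≤ 8 * ‖Λ‖ * Real.exp x → ‖ŵ x + 3 * ŝ x‖ ≤ 4 * N * Real.exp (30 * ρ₀ * Real.log (64 * ρ₀)) ∧ ‖ŵ x - 3 * ŝ x‖ ≤ 4 * N * Real.exp (30 * ρ₀ * Real.log (64 * ρ₀)) := by
  intro r W S hP hT Λ f g ŵ ŝ N B ρ₀ hX hρ hŵ hŝ hsol hsrc hB x hxe hxd
  have houter := cavity_outer_bound r W S hP hT Λ f g ŵ ŝ N B hX hŵ hŝ hsol hsrc hB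
  obtain ⟨hr, hr3, hW, hS, hSpos, -⟩ := hP
  obtain ⟨h0, hsup, hsub, -, -, -, hang, hWenv, hSenv, -⟩ := hT
  set X : ℝ := Λ.re with hXdef
  have hXpos : 0 < X := by linarith
  have hr2 : r < 2 := by
    have h13 : (1 : ℝ) < Real.sqrt 3 := (Real.lt_sqrt (by norm_num)).mpr (by norm_num)
    linarith
  -- `N ≥ 0`, `ρ₀ ≥ 1`
  have hN : 0 ≤ N := by
    have h := hsrc 0 (by norm_num)
    have : 0 ≤ ‖f 0‖ + Real.exp 0 * ‖g 0‖ := by positivity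
    linarith
  have hΛX : X ≤ ‖Λ‖ := le_trans (le_abs_self _) (Complex.abs_re_le_norm Λ)
  have hΛpos : 0 < ‖Λ‖ := by linarith
  have hρ1 : 1 ≤ ρ₀ := by
    by_contra h
    push Not at h
    have : ρ₀ * X < 1 * X := mul_lt_mul_of_pos_right h hXpos
    linarith
  -- the zone edge `x_e = log (8/X)` and the position of `x`
  set xe : ℝ := Real.log (8 / X) with hxedef
  have h8X : 0 < 8 / X := by positivity
  have hxe0 : xe < 0 := Real.log_neg h8X (by rw [div_lt_one hXpos]; linarith)
  have hexe : Real.exp (-xe) = X / 8 := by rw [hxedef, Real.exp_neg, Real.exp_log h8X, inv_div]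
  have hexe' : Real.exp xe = 8 / X := by rw [hxedef, Real.exp_log h8X]
  have hxle : x ≤ xe := by
    have h1 : Real.exp (-xe) ≤ Real.exp (-x) := by rw [hexe]; linarith
    have := Real.exp_le_exp.mp h1
    linarith
  have hex4 : Real.exp (-x) ≤ 8 * ‖Λ‖ :=
    calc Real.exp (-x) = Real.exp (-x) * 1 := (mul_one _).symm
      _ ≤ Real.exp (-x) * (8 * ‖Λ‖ * Real.exp x) := mul_le_mul_of_nonneg_left hxd (Real.exp_pos _).le
      _ = 8 * ‖Λ‖ * (Real.exp (-x) * Real.exp x) := by ring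
      _ = 8 * ‖Λ‖ := by rw [← Real.exp_add, neg_add_cancel, Real.exp_zero, mul_one]
  -- the data at `x_e` from the outer zone
  obtain ⟨hpe, hme⟩ := houter xe (by linarith) (by rw [hexe]; linarith)
  -- the reversed pair `F t = (p, m)(x_e - t)`
  set F : ℝ → ℂ × ℂ := fun t => (ŵ (xe - t) + 3 * ŝ (xe - t), ŵ (xe - t) - 3 * ŝ (xe - t)) with hF
  set F' : ℝ → ℂ × ℂ := fun t => (-(deriv ŵ (xe - t) + 3 * deriv ŝ (xe - t)),
    -(deriv ŵ (xe - t) - 3 * deriv ŝ (xe - t))) with hF'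
  have hFd : ∀ t, HasDerivAt F (F' t) t := by
    intro t
    have hl : HasDerivAt (fun t : ℝ => xe - t) (-1) t := by simpa using (hasDerivAt_id t).const_sub xe
    have h1 : HasDerivAt (fun t => ŵ (xe - t)) (-deriv ŵ (xe - t)) t := by
      have := (hŵ (xe - t)).hasDerivAt.scomp t hl
      simpa [Function.comp_def] using this
    have h2 : HasDerivAt (fun t => ŝ (xe - t)) (-deriv ŝ (xe - t)) t := by
      have := (hŝ (xe - t)).hasDerivAt.scomp t hl
      simpa [Function.comp_def] using this
    have hp := h1.add (h2.const_mul 3)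
    have hm := h1.sub (h2.const_mul 3)
    refine (hp.prodMk hm).congr_deriv ?_
    simp only [hF', Prod.mk.injEq]
    constructor <;> ring
  have hFc : ContinuousOn F (Icc 0 (xe - x)) := fun t _ => (hFd t).continuousAt.continuousWithinAt
  have hF0 : ‖F 0‖ ≤ 3 * N := by
    simp only [hF, sub_zero, Prod.norm_mk]
    exact max_le (by linarith) hme
  -- the derivative bound on the zone
  have hbound : ∀ t ∈ Ico 0 (xe - x), ‖F' t‖ ≤ 30 * ρ₀ * ‖F t‖ + 10 * N := by
    intro t ht
    set y : ℝ := xe - t with hy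
    have hy1 : y ≤ xe := by simp only [hy]; linarith [ht.1]
    have hy2 : y ≤ 1 := by linarith
    -- sizes at `y`
    obtain ⟨hWy, hW'y, -⟩ := hWenv y hy2
    obtain ⟨h7, h1, -, -⟩ := hSenv y hy2
    have hσ : |S y + deriv S y| ≤ 5 / 8 := by
      have h := hang y hy2
      obtain ⟨h₁, h₂⟩ := abs_le.mp hWy
      exact abs_le.mpr ⟨by linarith [neg_abs_le (S y + deriv S y)], by linarith [le_abs_self (S y + deriv S y)]⟩
    set e : ℝ := Real.exp (-y) with hedef
    have hepos : 0 < e := Real.exp_pos _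
    have hinv : e * Real.exp y = 1 := by rw [hedef, ← Real.exp_add, neg_add_cancel, Real.exp_zero]
    have he6 : 6 ≤ e := by
      have : Real.exp (-xe) ≤ e := Real.exp_le_exp.mpr (by linarith)
      rw [hexe] at this; linarith
    have hSe : S y ≤ e := by
      have := mul_le_mul_of_nonneg_left h1 hepos.le
      rwa [← mul_assoc, hinv, one_mul, mul_one] at this
    have hS7 : 7 / 10 * e ≤ S y := by
      have := mul_le_mul_of_nonneg_left h7 hepos.le
      rwa [← mul_assoc, hinv, one_mul, mul_comm] at this
    have hLe : ‖Λ‖ ≤ 8 * ρ₀ * e := by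
      have hXe : X ≤ 8 * e := by
        have : Real.exp (-xe) ≤ e := Real.exp_le_exp.mpr (by linarith)
        rw [hexe] at this; linarith
      nlinarith
    obtain ⟨hcp, hKp, hεp, hKm, hεm⟩ := junction_coeff_arith ρ₀ e (S y) (W y) (deriv W y) (deriv S y) r ‖Λ‖ hρ1 he6
      hS7 hSe hWy hW'y hσ hr hr2 hLe
    have hcm : 0 < 1 - W y + S y := by obtain ⟨h₁, h₂⟩ := abs_le.mp hWy; linarith [hSpos y]
    -- source sizes at `y`
    have hfg := hsrc y hy2
    have hf0 : 0 ≤ ‖f y‖ := norm_nonneg _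
    have hg0 : 0 ≤ ‖g y‖ := norm_nonneg _
    have hey : 0 < Real.exp y := Real.exp_pos y
    have hFn : ‖f y‖ ≤ N := by nlinarith
    have hGn : ‖g y‖ ≤ N * e := by
      have h1 : Real.exp y * ‖g y‖ ≤ N := by linarith
      have h2 := mul_le_mul_of_nonneg_left h1 hepos.le
      rwa [← mul_assoc, hinv, one_mul, mul_comm] at h2
    -- the characteristic system at `y`, row by row
    obtain ⟨c1, c2⟩ := char_system_src (hsol y hy2)
    set Z : ℝ := ‖F t‖ with hZ
    have hpZ : ‖ŵ y + 3 * ŝ y‖ ≤ Z := by simp only [hZ, hF, Prod.norm_mk]; exact le_max_left _ _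
    have hmZ : ‖ŵ y - 3 * ŝ y‖ ≤ Z := by simp only [hZ, hF, Prod.norm_mk]; exact le_max_right _ _
    have hZ0 : 0 ≤ Z := norm_nonneg _
    have hp' : ‖deriv ŵ y + 3 * deriv ŝ y‖ ≤ 30 * ρ₀ * Z + 10 * N :=
      row_deriv_bound _ _ (W y - 1 + S y) _ _ Z N ρ₀ hcp.ne' c1
        (row_norm_bound_p Λ _ _ (f y) (g y) _ _ Z N e hpZ hmZ hFn hGn) (by rw [abs_of_pos hcp]; exact hKp)
        (by rw [abs_of_pos hcp]; exact hεp) hZ0 hN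
    have hm' : ‖deriv ŵ y - 3 * deriv ŝ y‖ ≤ 30 * ρ₀ * Z + 10 * N := by
      have habs : |W y - 1 - S y| = 1 - W y + S y := by
        rw [abs_of_neg (by linarith)]; ring
      exact row_deriv_bound _ _ (W y - 1 - S y) _ _ Z N ρ₀ (by linarith : W y - 1 - S y < 0).ne c2
        (row_norm_bound_m Λ _ _ (f y) (g y) _ _ Z N e hpZ hmZ hFn hGn) (by rw [habs]; exact hKm)
        (by rw [habs]; exact hεm) hZ0 hN
    change ‖F' t‖ ≤ 30 * ρ₀ * Z + 10 * N
    simp only [hF', Prod.norm_mk, norm_neg]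
    exact max_le hp' hm'
  -- Grönwall
  have hG := norm_le_gronwallBound_of_norm_deriv_right_le hFc (fun t _ => (hFd t).hasDerivWithinAt) hF0 hbound
    (xe - x) ⟨by linarith, le_rfl⟩
  rw [sub_zero] at hG
  have hT : 30 * ρ₀ * (xe - x) ≤ 30 * ρ₀ * Real.log (64 * ρ₀) := by
    refine mul_le_mul_of_nonneg_left ?_ (by positivity)
    have h1 : Real.exp (xe - x) ≤ 64 * ρ₀ := by
      rw [Real.exp_sub, hexe', div_le_iff₀ (Real.exp_pos x)]
      have h2 : 8 / X * Real.exp (-x) ≤ 8 / X * (8 * ‖Λ‖) := mul_le_mul_of_nonneg_left hex4 h8X.le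
      have h3 : 8 / X * (8 * ‖Λ‖) ≤ 64 * ρ₀ := by
        rw [div_mul_eq_mul_div, div_le_iff₀ hXpos]; nlinarith
      have h4 : 8 / X = 8 / X * Real.exp (-x) * Real.exp x := by
        rw [mul_assoc, ← Real.exp_add, neg_add_cancel, Real.exp_zero, mul_one]
      rw [h4]
      exact mul_le_mul_of_nonneg_right (h2.trans h3) (Real.exp_pos x).le
    have := Real.log_le_log (Real.exp_pos _) h1
    rwa [Real.log_exp] at this
  have hGB : gronwallBound (3 * N) (30 * ρ₀) (10 * N) (xe - x) ≤ 4 * N * Real.exp (30 * ρ₀ * Real.log (64 * ρ₀)) :=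
    (gronwallBound_le_four N (30 * ρ₀) (xe - x) hN (by linarith) (by linarith)).trans
      (mul_le_mul_of_nonneg_left (Real.exp_le_exp.mpr hT) (by positivity))
  have hFx : F (xe - x) = (ŵ x + 3 * ŝ x, ŵ x - 3 * ŝ x) := by simp only [hF, sub_sub_cancel]
  rw [hFx, Prod.norm_mk] at hG
  exact ⟨(le_max_left _ _).trans (hG.trans hGB), (le_max_right _ _).trans (hG.trans hGB)⟩

end Summit.AtomisticToContinuum.HydrodynamicLimit.Theorems.SonicCavityRenewal

end
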